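import Literature.Barriers.CriticalPhenomena.LongRangeTrivialityOnZ3CriticalBeta
import HarnessLib

/-!
# The mean-field (Fisher 1967) bound for the LAYERED nearest-neighbour Ising model on `ℤ³`:
# `m*(β) > 0 ⇒ β·(4J∥ + 2J⊥) ≥ 1`, i.e. `k_B T_c ≤ 4J∥ + 2J⊥`

Topic `Literature/Probability/LatticeModels`; cell `pub/hubbard-tc` (MO-S3 ORDER → T_c back-end), seat
`hubbard-tc-mod-1` (ASSUMPTIONS.md §1, key K5 «XY-comparison»; lemma spec INTERLAYER-v0.1.md §6 L1).
Theorem file (one definition: the layered coupling; no named fact, no sorry). HONEST FRAMING: a theorem about a CLASSICAL effective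
model; its use for a material rests on the modelling key K5 (the layered superconductor's `T_c` is
at most the ordering temperature of the classical layered XY model with couplings = the certified
`T = 0` pair-phase stiffness ceilings) and on the published comparison plane-rotor ≤ Ising at half
the inverse temperature (Aizenman–Simon, Phys. Lett. 76A (1980) 281, eq. (2): `β_c^{rotor} ≥ 2β_c^{Ising}`,
NOT typed here) which turns `k_B T_c^{Ising} ≤ 4J∥ + 2J⊥` into `k_B T_c^{XY} ≤ 2J∥ + J⊥`
(= the referee's Simon–Lieb–Rivasseau rotor mean-field ceiling, VERDICTS.md §3).

Contents (namespace `Literature.Barriers.CriticalPhenomena.LongRangeIsing`, the general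
ferromagnetic-pair-interaction Ising framework of the barrier file `LongRangeTrivialityOnZ3`):

* `layeredCoupling J∥ J⊥ : Site 3 → Site 3 → ℝ` — `J∥` on in-plane nearest-neighbour bonds
  (`|x-y|₁ = 1`, third coordinates equal), `J⊥` on the `c`-axis bonds, `0` otherwise.
* `layeredCoupling_nonneg/_symm/_add` — ferromagnetic, symmetric, translation invariant.
* `sum_layeredCoupling_le` — row sums `∑_{y ∈ Λ} J_{x,y} ≤ 4J∥ + 2J⊥` for EVERY finite `Λ`
  (at most four in-plane and two axial neighbours).
* `one_le_mul_of_magnetization_pos_layered` — **the mean-field bound**: `0 ≤ β`, `m*(β) > 0 ⇒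
  1 ≤ β(4J∥ + 2J⊥)`, an instance of the tree's general Fisher bound
  `one_le_mul_of_magnetization_pos` (proved there from Griffiths' inequalities).
* `inv_le_criticalBeta_layered` — for `J∥, J⊥ > 0`: `(4J∥ + 2J⊥)⁻¹ ≤ β_c` (the set
  `{β > 0 | m*(β) > 0}` is inhabited by Peierls, tree `half_le_magnetization`, at
  `β = 4/min(J∥, J⊥)`), and `criticalBeta_layered_pos`.

References: M. E. Fisher, Phys. Rev. 162 (1967) 480 [Fisher1967IsingUpperBounds] (mean-field upper bound on
`T_c`, as cited by Panis 2023 §1.2.1 [Panis2023Triviality] and proved in the tree file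
`LongRangeTrivialityOnZ3HighTemperature`); L. L. Liu, H. E. Stanley, Phys. Lett. A 40 (1972) 272 [LiuStanley1972]
(the layered couplings `(J, J, εJ)`);
R. B. Griffiths, J. Math. Phys. 8 (1967) 478; M. Aizenman, B. Simon, Phys. Lett. 76A (1980) 281
(use, not typed); cell documents pub/hubbard-tc/ASSUMPTIONS.md §1, VERDICTS.md §3.
-/

noncomputable section

namespace Literature.Barriers.CriticalPhenomena

namespace LongRangeIsing

open Literature.Probability.LatticeModels Finset

/-! ### The layered nearest-neighbour coupling on `ℤ³` -/

/-- The **layered nearest-neighbour Ising coupling** on `ℤ³`: `J_{x,y} = J∥` if `x, y` are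
nearest neighbours in the same layer (`|x-y|₁ = 1` and `x₂ = y₂`), `J_{x,y} = J⊥` if they are
nearest neighbours along the stacking axis (`x - y = ±e₂`), and `0` otherwise — the "lattice
anisotropy" couplings `(J, J, εJ)` of Liu–Stanley on `ℤ³`, a ferromagnetic finite-range pair interaction in
the sense of Panis's §1.2.1. [cite: LiuStanley1972, p. 272 (layers (J, J, εJ))]
[cite: Panis2023Triviality, §1.2.1 (examples: nearest-neighbour interactions)] -/
def layeredCoupling (Jp Jz : ℝ) (x y : Site 3) : ℝ :=
  if l1Norm (x - y) = 1 then (if (x - y) 2 = 0 then Jp else Jz) else 0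

variable {Jp Jz : ℝ}

/-- The layered coupling is ferromagnetic (`J_{x,y} ≥ 0`) when `J∥, J⊥ ≥ 0` — standing assumption (A1)
of the source's framework. [cite: Panis2023Triviality, §1.2.1 (assumptions (A1)–(A5) on J)] -/
theorem layeredCoupling_nonneg (hp : 0 ≤ Jp) (hz : 0 ≤ Jz) (x y : Site 3) :
    0 ≤ layeredCoupling Jp Jz x y := by
  unfold layeredCoupling
  split_ifs <;> first | exact hp | exact hz | exact le_rfl

/-- The layered coupling is symmetric, `J_{x,y} = J_{y,x}` (pair interaction of the source's §1.2.1).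
[cite: Panis2023Triviality, §1.2.1 (H_{Λ,J,h}: symmetric pair interaction)] -/
theorem layeredCoupling_symm (x y : Site 3) :
    layeredCoupling Jp Jz x y = layeredCoupling Jp Jz y x := by
  unfold layeredCoupling
  have h2 : ((x - y) 2 = 0) ↔ ((y - x) 2 = 0) := by
    rw [← neg_sub y x, Pi.neg_apply, neg_eq_zero]
  rw [l1Norm_sub_comm]
  by_cases h : (y - x) 2 = 0
  · rw [if_pos (h2.2 h), if_pos h]
  · rw [if_neg (fun h' => h (h2.1 h')), if_neg h]

/-- The layered coupling is translation invariant, `J_{x+a,y+a} = J_{x,y}`.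
[cite: Panis2023Triviality, §1.2.1 (assumptions (A1)–(A5) on J: translation invariance)] -/
theorem layeredCoupling_add (a x y : Site 3) :
    layeredCoupling Jp Jz (x + a) (y + a) = layeredCoupling Jp Jz x y := by
  simp only [layeredCoupling, add_sub_add_right_eq_sub]

/-- On a nearest-neighbour bond the layered coupling is `J∥` or `J⊥`, hence at least
`min J∥ J⊥`. [folklore] -/
private theorem min_le_layeredCoupling_of_adj {x y : Site 3} (h : (zdGraph 3).Adj x y) :
    min Jp Jz ≤ layeredCoupling Jp Jz x y := by
  unfold layeredCoupling
  rw [if_pos (l1Norm_sub_eq_one_of_adj h)]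
  split_ifs
  · exact min_le_left _ _
  · exact min_le_right _ _

/-! ### Row sums: at most four in-plane and two axial neighbours -/

/-- A lattice vector of `ℓ¹` norm one with vanishing third coordinate is `±e₀` or `±e₁`. [folklore] -/
private theorem mem_inPlane_of_l1Norm_eq_one {z : Site 3} (hz : l1Norm z = 1) (hz2 : z 2 = 0) :
    z = Pi.single 0 1 ∨ z = -Pi.single 0 1 ∨ z = Pi.single 1 1 ∨ z = -Pi.single 1 1 := by
  obtain ⟨i, hi⟩ := eq_single_or_of_l1Norm_eq_one hz
  have hi2 : i ≠ 2 := by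
    rintro rfl
    rcases hi with h | h
    · rw [h] at hz2; simp at hz2
    · rw [h] at hz2; simp at hz2
  have hi01 : i = 0 ∨ i = 1 := by
    fin_cases i
    · exact Or.inl rfl
    · exact Or.inr rfl
    · exact absurd rfl hi2
  rcases hi01 with rfl | rfl
  · rcases hi with h | h
    · exact Or.inl h
    · exact Or.inr (Or.inl h)
  · rcases hi with h | h
    · exact Or.inr (Or.inr (Or.inl h))
    · exact Or.inr (Or.inr (Or.inr h))

/-- A lattice vector of `ℓ¹` norm one with non-vanishing third coordinate is `±e₂`. [folklore] -/
private theorem mem_axial_of_l1Norm_eq_one {z : Site 3} (hz : l1Norm z = 1) (hz2 : z 2 ≠ 0) :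
    z = Pi.single 2 1 ∨ z = -Pi.single 2 1 := by
  obtain ⟨i, hi⟩ := eq_single_or_of_l1Norm_eq_one hz
  have hi2 : i = 2 := by
    by_contra hne
    apply hz2
    rcases hi with h | h
    · rw [h, Pi.single_eq_of_ne (Ne.symm hne)]
    · rw [h, Pi.neg_apply, Pi.single_eq_of_ne (Ne.symm hne), neg_zero]
  subst hi2
  exact hi

/-- At most four sites of any finite set are in-plane nearest neighbours of `x`. [folklore] -/
private theorem card_filter_inPlane_le (Λ : Finset (Site 3)) (x : Site 3) :
    #(Λ.filter fun y => l1Norm (x - y) = 1 ∧ (x - y) 2 = 0) ≤ 4 := by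
  classical
  set S : Finset (Site 3) :=
    {Pi.single 0 1, -Pi.single 0 1, Pi.single 1 1, -Pi.single 1 1} with hS
  calc #(Λ.filter fun y => l1Norm (x - y) = 1 ∧ (x - y) 2 = 0)
      ≤ #(S.image fun z => x - z) := by
        refine Finset.card_le_card fun y hy => ?_
        rw [Finset.mem_filter] at hy
        refine Finset.mem_image.2 ⟨x - y, ?_, sub_sub_cancel x y⟩
        rcases mem_inPlane_of_l1Norm_eq_one hy.2.1 hy.2.2 with h | h | h | h <;>
          simp [hS, h]
    _ ≤ #S := Finset.card_image_le
    _ ≤ 4 := by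
        rw [hS]
        refine (Finset.card_insert_le _ _).trans ?_
        refine (Nat.add_le_add_right (Finset.card_insert_le _ _) 1).trans ?_
        refine (Nat.add_le_add_right (Nat.add_le_add_right (Finset.card_insert_le _ _) 1) 1).trans ?_
        simp

/-- At most two sites of any finite set are axial nearest neighbours of `x`. [folklore] -/
private theorem card_filter_axial_le (Λ : Finset (Site 3)) (x : Site 3) :
    #(Λ.filter fun y => l1Norm (x - y) = 1 ∧ (x - y) 2 ≠ 0) ≤ 2 := by
  classical
  set S : Finset (Site 3) := {Pi.single 2 1, -Pi.single 2 1} with hS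
  calc #(Λ.filter fun y => l1Norm (x - y) = 1 ∧ (x - y) 2 ≠ 0)
      ≤ #(S.image fun z => x - z) := by
        refine Finset.card_le_card fun y hy => ?_
        rw [Finset.mem_filter] at hy
        refine Finset.mem_image.2 ⟨x - y, ?_, sub_sub_cancel x y⟩
        rcases mem_axial_of_l1Norm_eq_one hy.2.1 hy.2.2 with h | h <;> simp [hS, h]
    _ ≤ #S := Finset.card_image_le
    _ ≤ 2 := by
        rw [hS]
        exact (Finset.card_insert_le _ _).trans (by simp)

/-- **Row sums of the layered coupling are at most `4J∥ + 2J⊥`** (for `J∥, J⊥ ≥ 0` and every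
finite `Λ ⊂ ℤ³`): the source's interaction norm `|J| := sup_x ∑_y J_{x,y}` (assumption (A2)) is at most
`4J∥ + 2J⊥` (four in-plane and two axial neighbours).
[cite: Panis2023Triviality, §1.2.1 (assumption (A2): |J| = sup_x Σ_y J_{x,y})] -/
theorem sum_layeredCoupling_le (hp : 0 ≤ Jp) (hz : 0 ≤ Jz) (Λ : Finset (Site 3)) (x : Site 3) :
    ∑ y ∈ Λ, layeredCoupling Jp Jz x y ≤ 4 * Jp + 2 * Jz := by
  classical
  have hpt : ∀ y, layeredCoupling Jp Jz x y =
      Jp * (if l1Norm (x - y) = 1 ∧ (x - y) 2 = 0 then 1 else 0) +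
      Jz * (if l1Norm (x - y) = 1 ∧ (x - y) 2 ≠ 0 then 1 else 0) := by
    intro y
    unfold layeredCoupling
    by_cases h1 : l1Norm (x - y) = 1
    · by_cases h2 : (x - y) 2 = 0
      · simp [h1, h2]
      · have h2' : x 2 - y 2 ≠ 0 := by simpa [Pi.sub_apply] using h2
        simp [h1, h2']
    · simp [h1]
  have hsum : ∑ y ∈ Λ, layeredCoupling Jp Jz x y =
      Jp * #(Λ.filter fun y => l1Norm (x - y) = 1 ∧ (x - y) 2 = 0) +
      Jz * #(Λ.filter fun y => l1Norm (x - y) = 1 ∧ (x - y) 2 ≠ 0) := by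
    simp_rw [hpt]
    rw [Finset.sum_add_distrib, ← Finset.mul_sum, ← Finset.mul_sum, Finset.sum_boole,
      Finset.sum_boole]
  rw [hsum]
  have h4 : (#(Λ.filter fun y => l1Norm (x - y) = 1 ∧ (x - y) 2 = 0) : ℝ) ≤ 4 := by
    exact_mod_cast card_filter_inPlane_le Λ x
  have h2 : (#(Λ.filter fun y => l1Norm (x - y) = 1 ∧ (x - y) 2 ≠ 0) : ℝ) ≤ 2 := by
    exact_mod_cast card_filter_axial_le Λ x
  nlinarith [mul_le_mul_of_nonneg_left h4 hp, mul_le_mul_of_nonneg_left h2 hz]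

/-! ### The mean-field bound and `β_c ≥ (4J∥ + 2J⊥)⁻¹` -/

/-- **Mean-field (Fisher 1967) bound for the layered Ising model on `ℤ³`.** If `J∥, J⊥ ≥ 0`,
`β ≥ 0` and the spontaneous magnetisation `m*(β)` is positive, then `β(4J∥ + 2J⊥) ≥ 1`; i.e.
`k_B T_c ≤ ∑_y J_{0,y} = 4J∥ + 2J⊥`. Instance of the tree's general bound
`one_le_mul_of_magnetization_pos` (Griffiths' inequalities) with the row-sum bound
`sum_layeredCoupling_le`. [cite: Panis2023Triviality, §1.2.1 (β_c ≥ |J|⁻¹, after Fisher 1967)]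
[cite: Fisher1967IsingUpperBounds, general mean-field upper bound k_BT_c ≤ Σ_j J_{0j} for anisotropic Ising lattices] -/
theorem one_le_mul_of_magnetization_pos_layered (hp : 0 ≤ Jp) (hz : 0 ≤ Jz) {β : ℝ} (hβ : 0 ≤ β)
    (hm : 0 < magnetization (layeredCoupling Jp Jz) β) : 1 ≤ β * (4 * Jp + 2 * Jz) :=
  one_le_mul_of_magnetization_pos (layeredCoupling Jp Jz) β hβ (layeredCoupling_nonneg hp hz)
    layeredCoupling_symm (fun L x _ => sum_layeredCoupling_le hp hz (box 3 L) x) hm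

/-- **Peierls for the layered model**: for `J∥, J⊥ > 0`, `m*(β) ≥ ½` at `β = 4/min(J∥, J⊥)`, so
the set `{β > 0 | m*(β) > 0}` defining `β_c` is inhabited (tree `half_le_magnetization`, `d = 3`).
[cite: Panis2023Triviality, §1.2.1 (β_c < ∞, after Peierls 1936)] -/
theorem four_div_min_mem_layered (hp : 0 < Jp) (hz : 0 < Jz) :
    4 / min Jp Jz ∈ {β : ℝ | 0 < β ∧ 0 < magnetization (layeredCoupling Jp Jz) β} := by
  have hmin : 0 < min Jp Jz := lt_min hp hz
  refine ⟨by positivity, lt_of_lt_of_le (by norm_num : (0 : ℝ) < 1 / 2) ?_⟩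
  exact half_le_magnetization (by norm_num) (layeredCoupling_nonneg hp.le hz.le)
    layeredCoupling_add hmin (fun x y hxy => min_le_layeredCoupling_of_adj hxy)
    (by rw [div_mul_cancel₀ _ hmin.ne'])

/-- **`β_c ≥ (4J∥ + 2J⊥)⁻¹` for the layered Ising model on `ℤ³`** (`J∥, J⊥ > 0`): the critical
temperature of the layered Ising model is at most its mean-field value `4J∥ + 2J⊥`. Combined with
Aizenman–Simon's `β_c^{rotor} ≥ 2β_c^{Ising}` (Phys. Lett. 76A (1980) 281; not typed here) this is
the layered-XY ceiling `k_B T_c ≤ 2J∥ + J⊥` used by `pub/hubbard-tc` (ASSUMPTIONS.md §1, key K5).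
[cite: Panis2023Triviality, §1.2.1 (β_c ≥ |J|⁻¹, after Fisher 1967)]
[cite: Fisher1967IsingUpperBounds, general mean-field upper bound for anisotropic Ising lattices] -/
theorem inv_le_criticalBeta_layered (hp : 0 < Jp) (hz : 0 < Jz) :
    (4 * Jp + 2 * Jz)⁻¹ ≤ criticalBeta (layeredCoupling Jp Jz) := by
  refine le_csInf ⟨_, four_div_min_mem_layered hp hz⟩ fun β hb => ?_
  have h1 : 1 ≤ β * (4 * Jp + 2 * Jz) :=
    one_le_mul_of_magnetization_pos_layered hp.le hz.le hb.1.le hb.2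
  have hS : (0 : ℝ) < 4 * Jp + 2 * Jz := by positivity
  rw [inv_le_iff_one_le_mul₀ hS]
  linarith

/-- `0 < β_c` for the layered Ising model with `J∥, J⊥ > 0` (the source's `β_c ∈ (0, ∞)`).
[cite: Panis2023Triviality, §1.2.1 (β_c ∈ (0,∞))] -/
theorem criticalBeta_layered_pos (hp : 0 < Jp) (hz : 0 < Jz) :
    0 < criticalBeta (layeredCoupling Jp Jz) :=
  lt_of_lt_of_le (by positivity) (inv_le_criticalBeta_layered hp hz)

end LongRangeIsing

end Literature.Barriers.CriticalPhenomena

end
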